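import Mathlib
import HarnessLib

/-!
# Route RellichScar — vocabulary posited by line `moment-conditioned-rellich` of the crux `ScarRigidity`
# (crux stmt-NavierStokesRegularity-11717)

Definitions, plus one registered glue lemma (`farDecay_anti`).  The line reduces `RellichScar.ScarRigidity` ("two singular apex Type-I profiles with
the same final-time trace off the origin coincide") to a LADDER of statements about the smooth representatives
`V₁, V₂ : ℝ → ℝ³ → ℝ³` of the two profiles and their Leray-gauge pressures `Q₁, Q₂`; the recurring sub-formulas of
that ladder are named here so that the registered stubs, their proofs and the sorry-free composition all speak
the same language:

* `ScaleInvariantBounds V Q` — the scale-invariant bound package of a velocity/pressure pair on the open backward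
  slab: `‖∇ⁿV(t,x)‖ ≤ L/(‖x‖+√(−t))^{1+n}`, `‖∇ⁿQ(t,x)‖ ≤ L/(‖x‖+√(−t))^{2+n}`, `‖∂ₜ∇ⁿV(t,x)‖ ≤ L/(‖x‖+√(−t))^{3+n}`
  for every `n` (with `L = L(n)`).  Higher time derivatives are deliberately absent (the Leray-gauge pressure of a
  Type-I profile carries a core-fed quadrupole `√(−t) q(t):∇²‖x‖⁻¹` in its far field, so `∂ₜQ`, `∂ₜ²V` are not
  one order better than `Q`, `∂ₜV` at spatial infinity).
* `FarDecay N V₁ V₂` — flatness of order `N` of the pair on the parabolic exterior `√(−t) ≤ ‖x‖`, with all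
  spatial derivatives: `‖∇ᵏ(V₁(t) − V₂(t))(x)‖ ≤ K (√(−t))⁻¹ (√(−t)/‖x‖)^N / ‖x‖^k` (`K = K(k)`).  `N = 3` is what the
  scar gives (`(−t)‖x‖⁻³`), `N = 4` the first rung of the painted ladder (`(−t)^{3/2}‖x‖⁻⁴`).
* `IsSolidHarmonic ℓ H` — solid harmonics of degree `ℓ` on `ℝ³` (smooth, positively homogeneous of degree `ℓ`,
  `ΔH = 0`; automatically harmonic polynomials).
* `momentIntegrand H V₁ V₂ t x = Σᵢⱼ ((V₁)ᵢ(V₁)ⱼ − (V₂)ᵢ(V₂)ⱼ)(t,x) ∂ᵢ∂ⱼH(x)` and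
  `RadiativeMomentsVanish ℓ V₁ V₂` — for every solid harmonic `H` of degree `ℓ` and every `t < 0` the RADIATIVE
  MOMENT `Q_ℓ[H](t) = ∫ momentIntegrand H V₁ V₂ t` of the Reynolds-stress defect `V₁⊗V₁ − V₂⊗V₂` converges
  absolutely and vanishes.  For `ℓ = 2` (`∇²H` = the constant symmetric trace-free matrices) this says that the
  trace-free part of `∫ (V₁⊗V₁ − V₂⊗V₂)(t) dx` — five functions of `t` — is zero; for `ℓ ≤ 1` it is vacuous.
  These are the coefficients of the far-field ("pressure-painted") expansion of `∇(Q₁ − Q₂)`,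
  `Q₁ − Q₂ = ℛᵢℛⱼ(V₁⊗V₁ − V₂⊗V₂)ᵢⱼ`, at order `‖x‖^{−ℓ−2}` (Stein, *Singular Integrals*, III §3; card
  `Cruxes/ScarRigidity/Ideas/moment-conditioned-rellich.md`).

Design: plain `def … : Prop` over Mathlib notions only (`iteratedFDeriv`, `deriv`, the `Laplacian` class `Δ`,
`EuclideanSpace.single`, Bochner integral); time first (`V t x`) as everywhere in the route; no measure-theoretic
a.e. forms are needed because the ladder is stated for the SMOOTH representatives delivered by
`Theorems/RellichScarScarRigidityApexMild.lean` (`stub_apexMildRepresentative`).  Nothing here restates a tree notion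
(`lean search` 2026-08-16: no `FarDecay` / `RadiativeMomentsVanish` / `IsSolidHarmonic` declared under `Literature` or
`Summits/…/Theorems`; two unrelated `ScaleInvariantBounds` live in other cruxes' work files, different namespaces).
-/

noncomputable section

open Set Function MeasureTheory
open scoped Laplacian

set_option linter.dupNamespace false

namespace Summit.NavierStokesRegularity.NavierStokesRegularity.Theorems.RellichScarScarRigidity

/-- Physical space. -/
local notation "ℝ³" => EuclideanSpace ℝ (Fin 3)

/-- **Scale-invariant bound package** of a velocity/pressure pair `(V, Q)` on the open backward slab
`(-∞,0) × ℝ³`: for every spatial order `n` there is `L` with `‖∇ⁿV(t,x)‖ ≤ L/(‖x‖+√(−t))^{1+n}`,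
`‖∇ⁿQ(t,x)‖ ≤ L/(‖x‖+√(−t))^{2+n}` and `‖∂ₜ∇ⁿV(t,x)‖ ≤ L/(‖x‖+√(−t))^{3+n}` for all `t < 0`, `x ∈ ℝ³`
(the bounds a Type-I ancient mild profile with the apex bound `‖V‖ ≤ C/(‖x‖+√(−t))` is expected to obey:
Koch–Nadirashvili–Seregin–Šverák 2009 Prop. 4.1 at the parabolic scale, local regularity at scale `‖x‖`). [folklore] -/
def ScaleInvariantBounds (V : ℝ → ℝ³ → ℝ³) (Q : ℝ → ℝ³ → ℝ) : Prop :=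
  ∀ n : ℕ, ∃ L : ℝ, ∀ t < 0, ∀ x : ℝ³,
    ‖iteratedFDeriv ℝ n (V t) x‖ ≤ L / (‖x‖ + Real.sqrt (-t)) ^ (1 + n) ∧
      ‖iteratedFDeriv ℝ n (Q t) x‖ ≤ L / (‖x‖ + Real.sqrt (-t)) ^ (2 + n) ∧
        ‖deriv (fun s => iteratedFDeriv ℝ n (V s) x) t‖ ≤ L / (‖x‖ + Real.sqrt (-t)) ^ (3 + n)

/-- **Flatness of order `N`** of the pair `(V₁, V₂)` on the parabolic exterior `√(−t) ≤ ‖x‖`, with all spatial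
derivatives: for every `k` there is `K` with
`‖∇ᵏ(V₁(t) − V₂(t))(x)‖ ≤ K (√(−t))⁻¹ (√(−t)/‖x‖)^N / ‖x‖^k` whenever `t < 0` and `√(−t) ≤ ‖x‖`.
Antitone in `N` (the ratio is at most one on the exterior). [folklore] -/
def FarDecay (N : ℕ) (V₁ V₂ : ℝ → ℝ³ → ℝ³) : Prop :=
  ∀ k : ℕ, ∃ K : ℝ, ∀ t < 0, ∀ x : ℝ³, Real.sqrt (-t) ≤ ‖x‖ →
    ‖iteratedFDeriv ℝ k (fun y => V₁ t y - V₂ t y) x‖ ≤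
      K * (Real.sqrt (-t))⁻¹ * (Real.sqrt (-t) / ‖x‖) ^ N / ‖x‖ ^ k

/-- `FarDecay` is **antitone in the order**: on the parabolic exterior `√(−t) ≤ ‖x‖` the ratio `√(−t)/‖x‖` is at most `1`, so
flatness of order `N` implies flatness of every order `N' ≤ N` (with the constant `max K 0`).  Registered glue of line
`moment-conditioned-rellich` (used by the composition `allOrders_of_ladder`). [folklore] -/
theorem farDecay_anti :
    ∀ {N N' : ℕ}, N' ≤ N → ∀ {V₁ V₂ : ℝ → ℝ³ → ℝ³}, FarDecay N V₁ V₂ → FarDecay N' V₁ V₂ := by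
  intro N N' h V₁ V₂ hN k
  obtain ⟨K, hK⟩ := hN k
  refine ⟨max K 0, fun t ht x hx => ?_⟩
  have hst : 0 < Real.sqrt (-t) := Real.sqrt_pos.2 (by linarith)
  have hxpos : 0 < ‖x‖ := hst.trans_le hx
  have hq0 : 0 ≤ Real.sqrt (-t) / ‖x‖ := div_nonneg hst.le hxpos.le
  have hq1 : Real.sqrt (-t) / ‖x‖ ≤ 1 := (div_le_one hxpos).2 hx
  have hpow : (Real.sqrt (-t) / ‖x‖) ^ N ≤ (Real.sqrt (-t) / ‖x‖) ^ N' :=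
    pow_le_pow_of_le_one hq0 hq1 h
  have hinv : 0 ≤ (Real.sqrt (-t))⁻¹ := inv_nonneg.2 hst.le
  have hxk : 0 < ‖x‖ ^ k := pow_pos hxpos k
  calc ‖iteratedFDeriv ℝ k (fun y => V₁ t y - V₂ t y) x‖
      ≤ K * (Real.sqrt (-t))⁻¹ * (Real.sqrt (-t) / ‖x‖) ^ N / ‖x‖ ^ k := hK t ht x hx
    _ ≤ max K 0 * (Real.sqrt (-t))⁻¹ * (Real.sqrt (-t) / ‖x‖) ^ N / ‖x‖ ^ k := by
        refine div_le_div_of_nonneg_right ?_ hxk.le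
        exact mul_le_mul_of_nonneg_right (mul_le_mul_of_nonneg_right (le_max_left _ _) hinv)
          (pow_nonneg hq0 _)
    _ ≤ max K 0 * (Real.sqrt (-t))⁻¹ * (Real.sqrt (-t) / ‖x‖) ^ N' / ‖x‖ ^ k := by
        refine div_le_div_of_nonneg_right ?_ hxk.le
        exact mul_le_mul_of_nonneg_left hpow (mul_nonneg (le_max_right _ _) hinv)

/-- **Solid harmonics of degree `ℓ`** on `ℝ³`: smooth functions, positively homogeneous of degree `ℓ`
(`H(r•x) = rˡ H(x)`, `r > 0`) and harmonic (`ΔH = 0`, Mathlib's `Laplacian`); such a function is a harmonic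
homogeneous polynomial of degree `ℓ` (Euler's identity and Taylor expansion at the origin). [folklore] -/
def IsSolidHarmonic (ℓ : ℕ) (H : ℝ³ → ℝ) : Prop :=
  ContDiff ℝ (⊤ : ℕ∞) H ∧ (∀ (r : ℝ) (x : ℝ³), 0 < r → H (r • x) = r ^ ℓ * H x) ∧ ∀ x, (Δ H) x = 0

/-- The integrand of the **radiative moment** of the Reynolds-stress defect of the pair `(V₁, V₂)` against
`H` at time `t`: `Σᵢⱼ ((V₁)ᵢ(V₁)ⱼ − (V₂)ᵢ(V₂)ⱼ)(t,x) · ∂ᵢ∂ⱼH(x)`, the Hessian entry being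
`D²H(x)(eᵢ, eⱼ)` with `eᵢ = EuclideanSpace.single i 1`. [folklore] -/
def momentIntegrand (H : ℝ³ → ℝ) (V₁ V₂ : ℝ → ℝ³ → ℝ³) (t : ℝ) (x : ℝ³) : ℝ :=
  ∑ i : Fin 3, ∑ j : Fin 3,
    ((V₁ t x) i * (V₁ t x) j - (V₂ t x) i * (V₂ t x) j) *
      iteratedFDeriv ℝ 2 H x ![EuclideanSpace.single i (1 : ℝ), EuclideanSpace.single j (1 : ℝ)]

/-- **The radiative moments of degree `ℓ` of the pair vanish**: for every solid harmonic `H` of degree `ℓ` and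
every `t < 0`, the moment integrand is integrable on `ℝ³` and `Q_ℓ[H](t) = ∫ momentIntegrand H V₁ V₂ t = 0`.
For `ℓ = 2` this is the vanishing of the trace-free part of `∫ (V₁⊗V₁ − V₂⊗V₂)(t) dx`; for `ℓ ≤ 1` it is vacuous
(`∇²H = 0`).  These numbers are the coefficients of the far-field multipole expansion of the pressure difference
`ℛᵢℛⱼ(V₁⊗V₁ − V₂⊗V₂)ᵢⱼ` at order `‖x‖^{−ℓ−1}` (Stein 1970, III §3). [folklore] -/
def RadiativeMomentsVanish (ℓ : ℕ) (V₁ V₂ : ℝ → ℝ³ → ℝ³) : Prop :=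
  ∀ H : ℝ³ → ℝ, IsSolidHarmonic ℓ H → ∀ t < 0,
    Integrable (momentIntegrand H V₁ V₂ t) volume ∧ ∫ x, momentIntegrand H V₁ V₂ t x = 0

/-! ## Appended 2026-08-16 (cycle 1, FSR reshape): Gaussian flatness -/

/-- **Gaussian flatness** of the pair `(V₁, V₂)` on the parabolic exterior `√(−t) ≤ ‖x‖`, with all spatial
derivatives, at scale-invariant Gaussian rates: for every `k` there are `M > 0` and `K` with
`‖∇ᵏ(V₁(t) − V₂(t))(x)‖ ≤ K (√(−t))⁻¹ exp(−M‖x‖²/(−t)) / ‖x‖ᵏ` (the rate may depend on `k`, as it does after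
interpolation; the second Carleman step only uses `k ≤ 2`).  In similarity variables
`y = x/√(−t)` this is `|∇ᵏW| ≲ e^{−M|y|²}`, the input of the second (anisotropic/radial) Carleman step of
Escauriaza–Seregin–Šverák (Seregin 2014, App. A, Lemma A.3; L. Wang 2014, Lemma 3.6). [folklore] -/
def GaussianFarDecay (V₁ V₂ : ℝ → ℝ³ → ℝ³) : Prop :=
  ∀ k : ℕ, ∃ M : ℝ, 0 < M ∧ ∃ K : ℝ, ∀ t < 0, ∀ x : ℝ³, Real.sqrt (-t) ≤ ‖x‖ →
    ‖iteratedFDeriv ℝ k (fun y => V₁ t y - V₂ t y) x‖ ≤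
      K * (Real.sqrt (-t))⁻¹ * Real.exp (-(M * ‖x‖ ^ 2 / (-t))) / ‖x‖ ^ k

/-- Gaussian flatness implies flatness of every order (`e^{−Mr²} ≤ N!·(Mr²)^{−N}`-type domination on the
exterior `r = ‖x‖/√(−t) ≥ 1`): the split loses nothing. [folklore] -/
theorem farDecay_of_gaussianFarDecay {V₁ V₂ : ℝ → ℝ³ → ℝ³}
    (h : GaussianFarDecay V₁ V₂) (N : ℕ) : FarDecay N V₁ V₂ := by
  intro k
  obtain ⟨M, hM, K, hK⟩ := h k
  -- `exp(-u) ≤ N! / u^N` for `u > 0`, from `u^N / N! ≤ exp u`.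
  refine ⟨max K 0 * (Nat.factorial N) / M ^ N, fun t ht x hx => ?_⟩
  have hst : 0 < Real.sqrt (-t) := Real.sqrt_pos.2 (by linarith)
  have hxpos : 0 < ‖x‖ := hst.trans_le hx
  have hnt : 0 < -t := by linarith
  have hxk : 0 < ‖x‖ ^ k := pow_pos hxpos k
  set u : ℝ := M * ‖x‖ ^ 2 / (-t) with hu
  have hupos : 0 < u := by positivity
  -- the elementary inequality `exp(-u) ≤ N! / u^N`
  have hexp : Real.exp (-u) ≤ (Nat.factorial N) / u ^ N := by
    have h1 : u ^ N / (Nat.factorial N) ≤ Real.exp u := by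
      have := Real.pow_div_factorial_le_exp (x := u) hupos.le N
      simpa using this
    have hfac : (0 : ℝ) < Nat.factorial N := by exact_mod_cast Nat.factorial_pos N
    have huN : 0 < u ^ N := pow_pos hupos N
    rw [Real.exp_neg, inv_eq_one_div, div_le_div_iff₀ (Real.exp_pos u) huN, one_mul]
    calc u ^ N = u ^ N / (Nat.factorial N) * (Nat.factorial N) := by field_simp
      _ ≤ Real.exp u * (Nat.factorial N) := mul_le_mul_of_nonneg_right h1 hfac.le
      _ = (Nat.factorial N) * Real.exp u := by ring
  -- `N!/u^N = N!/M^N · ((-t)/‖x‖²)^N = N!/M^N · (√(-t)/‖x‖)^(2N) ≤ N!/M^N · (√(-t)/‖x‖)^N`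
  have hq0 : 0 ≤ Real.sqrt (-t) / ‖x‖ := div_nonneg hst.le hxpos.le
  have hq1 : Real.sqrt (-t) / ‖x‖ ≤ 1 := (div_le_one hxpos).2 hx
  have huN_eq : u ^ N = M ^ N * ((‖x‖ ^ 2 / (-t))) ^ N := by
    rw [hu, ← mul_pow]; ring_nf
  have hratio : (‖x‖ ^ 2 / (-t))⁻¹ = (Real.sqrt (-t) / ‖x‖) ^ 2 := by
    rw [div_pow, Real.sq_sqrt hnt.le, inv_div]
  have hbound : (Nat.factorial N : ℝ) / u ^ N ≤ (Nat.factorial N) / M ^ N * (Real.sqrt (-t) / ‖x‖) ^ N := by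
    rw [huN_eq, div_mul_eq_div_div, div_eq_mul_inv _ ((‖x‖ ^ 2 / -t) ^ N), ← inv_pow, hratio, ← pow_mul]
    have hfacM : 0 ≤ (Nat.factorial N : ℝ) / M ^ N := by positivity
    refine mul_le_mul_of_nonneg_left ?_ hfacM
    exact pow_le_pow_of_le_one hq0 hq1 (by omega)
  have hinv : 0 ≤ (Real.sqrt (-t))⁻¹ := inv_nonneg.2 hst.le
  calc ‖iteratedFDeriv ℝ k (fun y => V₁ t y - V₂ t y) x‖
      ≤ K * (Real.sqrt (-t))⁻¹ * Real.exp (-(M * ‖x‖ ^ 2 / (-t))) / ‖x‖ ^ k := hK t ht x hx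
    _ ≤ max K 0 * (Real.sqrt (-t))⁻¹ * Real.exp (-u) / ‖x‖ ^ k := by
        refine div_le_div_of_nonneg_right ?_ hxk.le
        exact mul_le_mul_of_nonneg_right (mul_le_mul_of_nonneg_right (le_max_left _ _) hinv)
          (Real.exp_pos _).le
    _ ≤ max K 0 * (Real.sqrt (-t))⁻¹ * ((Nat.factorial N) / M ^ N * (Real.sqrt (-t) / ‖x‖) ^ N) /
          ‖x‖ ^ k := by
        refine div_le_div_of_nonneg_right ?_ hxk.le
        exact mul_le_mul_of_nonneg_left (hexp.trans hbound) (mul_nonneg (le_max_right _ _) hinv)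
    _ = max K 0 * (Nat.factorial N) / M ^ N * (Real.sqrt (-t))⁻¹ * (Real.sqrt (-t) / ‖x‖) ^ N /
          ‖x‖ ^ k := by ring

end Summit.NavierStokesRegularity.NavierStokesRegularity.Theorems.RellichScarScarRigidity

end
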